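import Summits.KontsevichZagierPeriods.KontsevichZagierPeriods.Theorems.HermiteRigidityReductionRigidityDupJoinKernelGen

/-!
# `ReductionRigidity` (stmt-KontsevichZagierPeriods-3407), line `Sketch`: the NORMAL FORM of the duplication tower of
# EVERY height (`stub_dupTowerNormalForm`)

Route `KontsevichZagierPeriods/HermiteRigidity`, crux `ReductionRigidity` (stmt-3407, summit-equivalent; skeleton
`Cruxes/ReductionRigidity/Lines/Sketch.lean` v7). Lead seat c7, growth item G15 (the duplication tower of every height;
`stub_dupJoinKernelGen` is the height `1`, `stub_dupTowerTwoKernelGen` the height `2`). The tower of height `H` over an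
integer `N ≥ 2` is the box sector generated by all rescaled box generators `[□ʲ, q x^a/(ν − ∏x)^m]` (`j ≤ w`, `q ∈ ℚ`) at the
`2H + 1` levels `ν = N^{2^k}` (`k ≤ H`) and `ν = −N^{2^k}` (`k < H`). This file proves its NORMAL FORM: every element of
the sector is congruent modulo `KZ.relations` to a rational combination of the normal forms `[□ⁱ, αᵢ/(N − ∏x)]` and
`[□ⁱ, β_{k,i}/((−N^{2^k}) − ∏x)]` (`i ≤ w`, `k < H`) — the `H` positive levels `N^{2^k}`, `k ≥ 1`, are ELIMINATED, storey by
storey from the top, by the weight-`i` duplication move chains `[□ⁱ, ε/(M² − ∏p)] ≡ 2^{i−1}[□ⁱ, ε/(M − ∏p)] + 2^{i−1}[□ⁱ, ε/((−M) − ∏p)]`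
(`stub_dupMoveGen` at `M = N^{2^k}`) — by induction on `H` (`stub_dupTowerNormalForm`). Tools: c4's `genReduction` at a
rational level with rational coefficients (`levelNormalFormQ`), and the merging of finitely many carriers of one additive
family (`sum_carriers`, `sum_carriers_zero`). The kernel form of Conjecture 1 on the tower (rigidity of
`1, Li_s(1/N), Li_s(−1/N^{2^k})` inlined, resp. PROVED for `log N ≥ 4^{H+1}(w+1)³`) is drawn in the sibling file
`HermiteRigidityReductionRigidityDupTowerKernelGen.lean`.

References: M. Kontsevich, D. Zagier, *Periods* (2001), §1.2 [cite: KontsevichZagier2001, §1.2]. No definitions are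
introduced (normal forms are written out as existentials).
-/

noncomputable section

open MeasureTheory Set MvPolynomial

namespace Summit.KontsevichZagierPeriods.HermiteRigidity.ReductionRigidity

open Literature.NumberTheory.Transcendental
open Literature.NumberTheory.Transcendental.KZ

/-! ## Tools -/

/-- Generic normal form on the level-`ν` box sector of dimensions `≤ w` with RATIONAL coefficients `q` on the generators
(c4's closure induction over `genReduction`, which already allows the coefficient). [cite: KontsevichZagier2001, §1.2] -/
theorem levelNormalFormQ {ν : ℚ} (hν : 1 < ν ∨ ν < 0) (w : ℕ) :
    ∀ c ∈ AddSubgroup.closure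
      {c | ∃ (j : ℕ) (r : IntegralRep j) (q : ℚ) (a : Fin j → ℕ) (m : ℕ), j ≤ w ∧ r.domain = cube j ∧
          EqOn r.integrand (fun p => (q : ℝ) * (∏ l, p l ^ a l) / ((ν : ℝ) - ∏ l, p l) ^ m) (cube j) ∧ c = KZ.of r},
    ∃ (α : ℕ → ℚ) (s : (i : ℕ) → IntegralRep i),
      (∀ i, (s i).domain = cube i ∧ EqOn (s i).integrand (fun p => (α i : ℝ) / ((ν : ℝ) - ∏ l, p l)) (cube i)) ∧
      c - ∑ i ∈ Finset.range (w + 1), KZ.of (s i) ∈ KZ.relations := by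
  intro c hc
  induction hc using AddSubgroup.closure_induction with
  | mem x hx =>
    obtain ⟨j, r, q, a, m, hjw, hr, hri, rfl⟩ := hx
    exact genReduction hν j hjw m q a r hr hri
  | zero => exact gnf_zero hν w
  | add x y _ _ hx hy => exact gnf_add hν hx hy
  | neg x _ hx => exact gnf_neg hν hx

/-- Merging finitely many carriers of one additive family with a common domain: the carriers `s 0, …, s (K−1)` with
parameters `β k` are congruent, in sum, to ONE carrier with parameter `∑_{k<K} β k` (repeated `carrier_add`).
[cite: KontsevichZagier2001, §1.2 rule (1)] -/
theorem sum_carriers {n : ℕ} {D : Set (Fin n → ℝ)} (f : ℚ → (Fin n → ℝ) → ℝ)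
    (hf : ∀ β β' x, f (β + β') x = f β x + f β' x) (hf0 : ∀ x, f 0 x = 0)
    (hex : ∀ β : ℚ, ∃ s : IntegralRep n, s.domain = D ∧ EqOn s.integrand (f β) D)
    (β : ℕ → ℚ) (s : ℕ → IntegralRep n) (hs : ∀ k, (s k).domain = D ∧ EqOn (s k).integrand (f (β k)) D) :
    ∀ K : ℕ, ∃ u : IntegralRep n, u.domain = D ∧ EqOn u.integrand (f (∑ k ∈ Finset.range K, β k)) D ∧
      ∑ k ∈ Finset.range K, KZ.of (s k) - KZ.of u ∈ KZ.relations := by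
  intro K
  induction K with
  | zero =>
    obtain ⟨u, hu, hui⟩ := hex 0
    refine ⟨u, hu, fun x hx => by rw [hui hx, Finset.sum_range_zero], ?_⟩
    rw [Finset.sum_range_zero, zero_sub, neg_mem_iff]
    exact carrier_zero f hf0 hu hui
  | succ K ih =>
    obtain ⟨u, hu, hui, hrel⟩ := ih
    obtain ⟨u', hu', hui'⟩ := hex (∑ k ∈ Finset.range K, β k + β K)
    refine ⟨u', hu', fun x hx => by rw [hui' hx, Finset.sum_range_succ], ?_⟩
    have e := carrier_add f hf hu hui (hs K).1 (hs K).2 hu' hui'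
    have : ∑ k ∈ Finset.range (K + 1), KZ.of (s k) - KZ.of u' =
        (∑ k ∈ Finset.range K, KZ.of (s k) - KZ.of u) - (KZ.of u' - KZ.of u - KZ.of (s K)) := by
      rw [Finset.sum_range_succ]; abel
    rw [this]
    exact KZ.relations.sub_mem hrel e

/-- Finitely many carriers of one additive family whose parameters sum to `0` add up to a relation.
[cite: KontsevichZagier2001, §1.2 rule (1)] -/
theorem sum_carriers_zero {n : ℕ} {D : Set (Fin n → ℝ)} (f : ℚ → (Fin n → ℝ) → ℝ)
    (hf : ∀ β β' x, f (β + β') x = f β x + f β' x) (hf0 : ∀ x, f 0 x = 0)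
    (hex : ∀ β : ℚ, ∃ s : IntegralRep n, s.domain = D ∧ EqOn s.integrand (f β) D)
    (β : ℕ → ℚ) (s : ℕ → IntegralRep n) (hs : ∀ k, (s k).domain = D ∧ EqOn (s k).integrand (f (β k)) D)
    {K : ℕ} (hsum : ∑ k ∈ Finset.range K, β k = 0) :
    ∑ k ∈ Finset.range K, KZ.of (s k) ∈ KZ.relations := by
  obtain ⟨u, hu, hui, hrel⟩ := sum_carriers f hf hf0 hex β s hs K
  have z : KZ.of u ∈ KZ.relations := carrier_zero f hf0 hu (by rw [hsum] at hui; exact hui)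
  have : ∑ k ∈ Finset.range K, KZ.of (s k) = (∑ k ∈ Finset.range K, KZ.of (s k) - KZ.of u) + KZ.of u := by abel
  rw [this]
  exact KZ.relations.add_mem hrel z

/-! ## The normal form of the tower -/

/-- **Stub `stub_dupTowerNormalForm`** (sub-goal of crux `ReductionRigidity`, stmt-3407, line `Sketch`, lead c7, growth
G15): **the normal form of the duplication tower of height `H`.** For integers `N ≥ 2`, `w` and `H`, every element of the
subgroup generated by the rescaled box generators `[□ʲ, q x^a/(ν − ∏x)^m]` (`j ≤ w`, `q ∈ ℚ`) at the levels `ν = N^{2^k}`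
(`k ≤ H`) and `ν = −N^{2^k}` (`k < H`) is congruent modulo `KZ.relations` to
`∑_{i ≤ w} [□ⁱ, αᵢ/(N − ∏x)] + ∑_{k<H} ∑_{i ≤ w} [□ⁱ, β_{k,i}/((−N^{2^k}) − ∏x)]` with rational `α`, `β`. Induction on `H`:
normal forms at the two new levels `−N^{2^H}`, `N^{2^{H+1}}` (`levelNormalFormQ`); the top level is pushed to `±N^{2^H}` by
the duplication move chains `stub_dupMoveGen` at `M = N^{2^H}` (its constant becomes a level-`N` generator of dimension `0`),
the `+N^{2^H}` parts are generators of the tower of height `H` (induction hypothesis), the `−N^{2^H}` parts are merged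
dimension by dimension (`carrier_add`). [cite: KontsevichZagier2001, §1.2] -/
theorem stub_dupTowerNormalForm : ∀ (N w : ℕ), 2 ≤ N → ∀ (H : ℕ), ∀ c ∈ AddSubgroup.closure
      ({c | ∃ (k j : ℕ) (r : IntegralRep j) (q : ℚ) (a : Fin j → ℕ) (m : ℕ), k ≤ H ∧ j ≤ w ∧ r.domain = cube j ∧
          EqOn r.integrand (fun p => (q : ℝ) * (∏ l, p l ^ a l) / ((N : ℝ) ^ (2 ^ k) - ∏ l, p l) ^ m) (cube j) ∧
            c = KZ.of r} ∪
        {c | ∃ (k j : ℕ) (r : IntegralRep j) (q : ℚ) (a : Fin j → ℕ) (m : ℕ), k < H ∧ j ≤ w ∧ r.domain = cube j ∧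
          EqOn r.integrand (fun p => (q : ℝ) * (∏ l, p l ^ a l) / ((-((N : ℝ) ^ (2 ^ k))) - ∏ l, p l) ^ m) (cube j) ∧
            c = KZ.of r}),
    ∃ (α : ℕ → ℚ) (β : ℕ → ℕ → ℚ) (s : (i : ℕ) → IntegralRep i) (t : ℕ → (i : ℕ) → IntegralRep i),
      (∀ i, (s i).domain = cube i ∧ EqOn (s i).integrand (fun p => (α i : ℝ) / ((N : ℝ) - ∏ l, p l)) (cube i)) ∧
      (∀ k i, (t k i).domain = cube i ∧
        EqOn (t k i).integrand (fun p => (β k i : ℝ) / ((-((N : ℝ) ^ (2 ^ k))) - ∏ l, p l)) (cube i)) ∧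
      c - (∑ i ∈ Finset.range (w + 1), KZ.of (s i) +
        ∑ k ∈ Finset.range H, ∑ i ∈ Finset.range (w + 1), KZ.of (t k i)) ∈ KZ.relations := by
  intro N w hN H
  have hν₁ : (1 : ℚ) < N ∨ (N : ℚ) < 0 := natLevel hN
  have h2Q : (2 : ℚ) ≤ N := by exact_mod_cast hN
  have hνneg : ∀ k : ℕ, (1 : ℚ) < (-((N : ℚ) ^ (2 ^ k))) ∨ (-((N : ℚ) ^ (2 ^ k))) < 0 := fun k =>
    Or.inr (neg_lt_zero.2 (by positivity))
  have cN : (((N : ℚ)) : ℝ) = (N : ℝ) := Rat.cast_natCast N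
  have cNeg : ∀ k : ℕ, (((-((N : ℚ) ^ (2 ^ k))) : ℚ) : ℝ) = -((N : ℝ) ^ (2 ^ k)) := fun k => by push_cast; ring
  induction H with
  | zero =>
    intro c hc
    choose t ht hti using fun (k i : ℕ) => exists_nfRep (i := i) (hνneg k) 0
    obtain ⟨α, s, hs, hrel⟩ := levelNormalFormQ hν₁ w c (by
      refine AddSubgroup.closure_mono (fun c hc => ?_) hc
      rcases hc with hc | hc
      · obtain ⟨k, j, r, q, a, m, hk, hj, hr, hri, rfl⟩ := hc
        have hk0 : k = 0 := Nat.le_zero.1 hk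
        subst hk0
        exact ⟨j, r, q, a, m, hj, hr, fun p hp => by rw [hri hp, pow_zero, pow_one, cN], rfl⟩
      · obtain ⟨k, j, r, q, a, m, hk, -⟩ := hc
        exact absurd hk (Nat.not_lt_zero k))
    refine ⟨α, fun _ _ => 0, s, t, fun i => ⟨(hs i).1, fun p hp => by rw [(hs i).2 hp, cN]⟩,
      fun k i => ⟨ht k i, fun p hp => by rw [hti k i hp, cNeg k]⟩, ?_⟩
    simpa using hrel
  | succ H ih =>
    intro c hc
    -- the natural level `M = N^(2^H)` of the duplication moves, and the casts
    have hM2 : 2 ≤ N ^ 2 ^ H := le_trans hN (Nat.le_self_pow (pow_ne_zero _ two_ne_zero) N)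
    have hνM : (1 : ℚ) < ((N ^ 2 ^ H : ℕ) : ℚ) ∨ ((N ^ 2 ^ H : ℕ) : ℚ) < 0 := natLevel hM2
    have h2M : (2 : ℚ) ≤ ((N ^ 2 ^ H : ℕ) : ℚ) := by exact_mod_cast hM2
    have hνMneg : (1 : ℚ) < (-((N ^ 2 ^ H : ℕ) : ℚ)) ∨ (-((N ^ 2 ^ H : ℕ) : ℚ)) < 0 := Or.inr (by linarith)
    have hνTop : (1 : ℚ) < (((N ^ 2 ^ H : ℕ) : ℚ) ^ 2) ∨ (((N ^ 2 ^ H : ℕ) : ℚ) ^ 2) < 0 := Or.inl (by nlinarith)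
    have cM : ((((N ^ 2 ^ H : ℕ) : ℚ)) : ℝ) = (N : ℝ) ^ (2 ^ H) := by push_cast; ring
    have cMneg : (((-((N ^ 2 ^ H : ℕ) : ℚ)) : ℚ) : ℝ) = -((N : ℝ) ^ (2 ^ H)) := by push_cast; ring
    have cTop : (((((N ^ 2 ^ H : ℕ) : ℚ) ^ 2) : ℚ) : ℝ) = (N : ℝ) ^ (2 ^ (H + 1)) := by
      push_cast; rw [← pow_mul, pow_succ]
    have cMR : ((N ^ 2 ^ H : ℕ) : ℝ) = (N : ℝ) ^ (2 ^ H) := by push_cast; ring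
    have cTopR : ((N ^ 2 ^ H : ℕ) : ℝ) ^ 2 = (N : ℝ) ^ (2 ^ (H + 1)) := by rw [cMR, ← pow_mul, pow_succ]
    -- split `c` along: the tower of height `H`, the level `−N^(2^H)`, the level `N^(2^(H+1))`
    have hsub :
        ({c | ∃ (k j : ℕ) (r : IntegralRep j) (q : ℚ) (a : Fin j → ℕ) (m : ℕ), k ≤ H + 1 ∧ j ≤ w ∧ r.domain = cube j ∧
            EqOn r.integrand (fun p => (q : ℝ) * (∏ l, p l ^ a l) / ((N : ℝ) ^ (2 ^ k) - ∏ l, p l) ^ m) (cube j) ∧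
              c = KZ.of r} ∪
          {c | ∃ (k j : ℕ) (r : IntegralRep j) (q : ℚ) (a : Fin j → ℕ) (m : ℕ), k < H + 1 ∧ j ≤ w ∧ r.domain = cube j ∧
            EqOn r.integrand (fun p => (q : ℝ) * (∏ l, p l ^ a l) / ((-((N : ℝ) ^ (2 ^ k))) - ∏ l, p l) ^ m) (cube j) ∧
              c = KZ.of r} : Set FormalRep) ⊆
        ({c | ∃ (k j : ℕ) (r : IntegralRep j) (q : ℚ) (a : Fin j → ℕ) (m : ℕ), k ≤ H ∧ j ≤ w ∧ r.domain = cube j ∧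
            EqOn r.integrand (fun p => (q : ℝ) * (∏ l, p l ^ a l) / ((N : ℝ) ^ (2 ^ k) - ∏ l, p l) ^ m) (cube j) ∧
              c = KZ.of r} ∪
          {c | ∃ (k j : ℕ) (r : IntegralRep j) (q : ℚ) (a : Fin j → ℕ) (m : ℕ), k < H ∧ j ≤ w ∧ r.domain = cube j ∧
            EqOn r.integrand (fun p => (q : ℝ) * (∏ l, p l ^ a l) / ((-((N : ℝ) ^ (2 ^ k))) - ∏ l, p l) ^ m) (cube j) ∧
              c = KZ.of r}) ∪
        {c | ∃ (j : ℕ) (r : IntegralRep j) (q : ℚ) (a : Fin j → ℕ) (m : ℕ), j ≤ w ∧ r.domain = cube j ∧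
            EqOn r.integrand (fun p => (q : ℝ) * (∏ l, p l ^ a l) /
              ((((-((N ^ 2 ^ H : ℕ) : ℚ)) : ℚ) : ℝ) - ∏ l, p l) ^ m) (cube j) ∧ c = KZ.of r} ∪
        {c | ∃ (j : ℕ) (r : IntegralRep j) (q : ℚ) (a : Fin j → ℕ) (m : ℕ), j ≤ w ∧ r.domain = cube j ∧
            EqOn r.integrand (fun p => (q : ℝ) * (∏ l, p l ^ a l) /
              ((((((N ^ 2 ^ H : ℕ) : ℚ) ^ 2) : ℚ) : ℝ) - ∏ l, p l) ^ m) (cube j) ∧ c = KZ.of r} := by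
      rintro c (hc | hc)
      · obtain ⟨k, j, r, q, a, m, hk, hj, hr, hri, rfl⟩ := hc
        rcases Nat.lt_or_ge k (H + 1) with hk' | hk'
        · exact Or.inl (Or.inl (Or.inl ⟨k, j, r, q, a, m, Nat.lt_succ_iff.1 hk', hj, hr, hri, rfl⟩))
        · have hkH : k = H + 1 := le_antisymm hk hk'
          subst hkH
          exact Or.inr ⟨j, r, q, a, m, hj, hr, fun p hp => by rw [hri hp, cTop], rfl⟩
      · obtain ⟨k, j, r, q, a, m, hk, hj, hr, hri, rfl⟩ := hc
        rcases Nat.lt_or_ge k H with hk' | hk'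
        · exact Or.inl (Or.inl (Or.inr ⟨k, j, r, q, a, m, hk', hj, hr, hri, rfl⟩))
        · have hkH : k = H := by omega
          subst hkH
          exact Or.inl (Or.inr ⟨j, r, q, a, m, hj, hr, fun p hp => by rw [hri hp, cMneg], rfl⟩)
    have hc' := AddSubgroup.closure_mono hsub hc
    rw [AddSubgroup.closure_union, AddSubgroup.closure_union] at hc'
    obtain ⟨xy, hxy, z, hz, rfl⟩ := AddSubgroup.mem_sup.1 hc'
    obtain ⟨x, hx, y, hy, rfl⟩ := AddSubgroup.mem_sup.1 hxy
    -- normal forms at the two new levels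
    obtain ⟨δ, v, hv, hyv⟩ := levelNormalFormQ hνMneg w y hy
    obtain ⟨η, zr, hzr, hzz⟩ := levelNormalFormQ hνTop w z hz
    -- the duplication move chains at `M = N^(2^H)`: level `N^(2^(H+1)) ↦ N^(2^H), −N^(2^H)`
    choose uP huP huPi using fun i : ℕ => exists_nfRep (i := i + 1) hνM (2 ^ i * η (i + 1))
    choose vP hvP hvPi using fun i : ℕ => exists_nfRep (i := i + 1) hνMneg (2 ^ i * η (i + 1))
    have hmove : ∀ i, KZ.of (zr (i + 1)) - KZ.of (uP i) - KZ.of (vP i) ∈ KZ.relations := by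
      intro i
      refine stub_dupMoveGen (N ^ 2 ^ H) hM2 (i + 1) (Nat.succ_pos i) (η (i + 1)) (zr (i + 1)) (uP i) (vP i)
        (hzr (i + 1)).1 (fun p hp => ?_) (huP i) (fun p hp => ?_) (hvP i) (fun p hp => ?_)
      · rw [(hzr (i + 1)).2 hp]; push_cast; ring
      · rw [huPi i hp, Nat.add_sub_cancel]; push_cast; ring
      · rw [hvPi i hp, Nat.add_sub_cancel]; push_cast; ring
    -- merge the two level-`−N^(2^H)` carriers in each dimension
    choose tM htM htMi using fun i : ℕ =>
      exists_nfRep (i := i) hνMneg (δ i + (if i = 0 then 0 else 2 ^ (i - 1) * η i))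
    have hmerge : ∀ i, KZ.of (tM (i + 1)) - KZ.of (v (i + 1)) - KZ.of (vP i) ∈ KZ.relations := by
      intro i
      refine carrier_add (D := cube (i + 1)) (fun b p => (b : ℝ) / ((((-((N ^ 2 ^ H : ℕ) : ℚ)) : ℚ) : ℝ) - ∏ l, p l))
        (fun b b' p => by push_cast; ring) (hv (i + 1)).1 (hv (i + 1)).2 (hvP i) (hvPi i) (htM (i + 1))
        (fun p hp => ?_)
      rw [htMi (i + 1) hp, if_neg (Nat.succ_ne_zero i), Nat.add_sub_cancel]
    have hmerge0 : KZ.of (tM 0) - KZ.of (v 0) ∈ KZ.relations := by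
      obtain ⟨z0, hz0, hz0i⟩ := exists_nfRep (i := 0) hνMneg 0
      have e := carrier_add (D := cube 0) (fun b p => (b : ℝ) / ((((-((N ^ 2 ^ H : ℕ) : ℚ)) : ℚ) : ℝ) - ∏ l, p l))
        (fun b b' p => by push_cast; ring) (hv 0).1 (hv 0).2 hz0 hz0i (htM 0)
        (fun p hp => by rw [htMi 0 hp, if_pos rfl])
      have hz : KZ.of z0 ∈ KZ.relations :=
        carrier_zero (D := cube 0) (fun b p => (b : ℝ) / ((((-((N ^ 2 ^ H : ℕ) : ℚ)) : ℚ) : ℝ) - ∏ l, p l))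
          (fun p => by simp) hz0 hz0i
      have : KZ.of (tM 0) - KZ.of (v 0) = (KZ.of (tM 0) - KZ.of (v 0) - KZ.of z0) + KZ.of z0 := by abel
      rw [this]
      exact KZ.relations.add_mem e hz
    -- the `+N^(2^H)` parts and the top constant are generators of the tower of height `H`: induction
    have hx' : x + KZ.of (zr 0) + ∑ i ∈ Finset.range w, KZ.of (uP i) ∈ AddSubgroup.closure
        ({c | ∃ (k j : ℕ) (r : IntegralRep j) (q : ℚ) (a : Fin j → ℕ) (m : ℕ), k ≤ H ∧ j ≤ w ∧ r.domain = cube j ∧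
            EqOn r.integrand (fun p => (q : ℝ) * (∏ l, p l ^ a l) / ((N : ℝ) ^ (2 ^ k) - ∏ l, p l) ^ m) (cube j) ∧
              c = KZ.of r} ∪
          {c | ∃ (k j : ℕ) (r : IntegralRep j) (q : ℚ) (a : Fin j → ℕ) (m : ℕ), k < H ∧ j ≤ w ∧ r.domain = cube j ∧
            EqOn r.integrand (fun p => (q : ℝ) * (∏ l, p l ^ a l) / ((-((N : ℝ) ^ (2 ^ k))) - ∏ l, p l) ^ m) (cube j) ∧
              c = KZ.of r}) := by
      refine AddSubgroup.add_mem _ (AddSubgroup.add_mem _ hx (AddSubgroup.subset_closure ?_))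
        (AddSubgroup.sum_mem _ fun i hi => AddSubgroup.subset_closure ?_)
      · refine Or.inl ⟨0, 0, zr 0, η 0 / (((N ^ 2 ^ H : ℕ) : ℚ) ^ 2 - 1), Fin.elim0, 0, Nat.zero_le _, Nat.zero_le _,
          (hzr 0).1, fun p hp => ?_, rfl⟩
        rw [(hzr 0).2 hp]
        simp [Finset.univ_eq_empty]
      · refine Or.inl ⟨H, i + 1, uP i, 2 ^ i * η (i + 1), 0, 1, le_rfl, Nat.succ_le_of_lt (Finset.mem_range.1 hi),
          huP i, fun p hp => ?_, rfl⟩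
        rw [huPi i hp, cM]
        simp
    obtain ⟨α, β, s, t, hs, ht, hrelx⟩ := ih _ hx'
    refine ⟨α, fun k i => if k = H then δ i + (if i = 0 then 0 else 2 ^ (i - 1) * η i) else β k i, s,
      fun k i => if k = H then tM i else t k i, hs, fun k i => ?_, ?_⟩
    · by_cases hk : k = H
      · simp only [hk, if_true]
        exact ⟨htM i, fun p hp => by rw [htMi i hp, cMneg]⟩
      · simp only [hk, if_false]
        exact ht k i
    · have hsum_t : ∑ k ∈ Finset.range (H + 1), ∑ i ∈ Finset.range (w + 1), KZ.of (if k = H then tM i else t k i) =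
          ∑ k ∈ Finset.range H, ∑ i ∈ Finset.range (w + 1), KZ.of (t k i) +
            ∑ i ∈ Finset.range (w + 1), KZ.of (tM i) := by
        rw [Finset.sum_range_succ]
        congr 1
        · refine Finset.sum_congr rfl fun k hk => Finset.sum_congr rfl fun i _ => ?_
          rw [if_neg (Nat.ne_of_lt (Finset.mem_range.1 hk))]
        · refine Finset.sum_congr rfl fun i _ => ?_
          rw [if_pos rfl]
      rw [hsum_t]
      have key : x + y + z - (∑ i ∈ Finset.range (w + 1), KZ.of (s i) +
          (∑ k ∈ Finset.range H, ∑ i ∈ Finset.range (w + 1), KZ.of (t k i) +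
            ∑ i ∈ Finset.range (w + 1), KZ.of (tM i))) =
          (x + KZ.of (zr 0) + ∑ i ∈ Finset.range w, KZ.of (uP i) -
            (∑ i ∈ Finset.range (w + 1), KZ.of (s i) +
              ∑ k ∈ Finset.range H, ∑ i ∈ Finset.range (w + 1), KZ.of (t k i))) +
          (y - ∑ i ∈ Finset.range (w + 1), KZ.of (v i)) + (z - ∑ i ∈ Finset.range (w + 1), KZ.of (zr i)) +
          ∑ i ∈ Finset.range w, (KZ.of (zr (i + 1)) - KZ.of (uP i) - KZ.of (vP i)) -
          ∑ i ∈ Finset.range w, (KZ.of (tM (i + 1)) - KZ.of (v (i + 1)) - KZ.of (vP i)) -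
          (KZ.of (tM 0) - KZ.of (v 0)) := by
        rw [Finset.sum_range_succ' (fun i => KZ.of (v i)), Finset.sum_range_succ' (fun i => KZ.of (zr i)),
          Finset.sum_range_succ' (fun i => KZ.of (tM i))]
        simp only [Finset.sum_sub_distrib]
        abel
      rw [key]
      exact KZ.relations.sub_mem (KZ.relations.sub_mem (KZ.relations.add_mem (KZ.relations.add_mem
        (KZ.relations.add_mem hrelx hyv) hzz) (KZ.relations.sum_mem fun i _ => hmove i))
        (KZ.relations.sum_mem fun i _ => hmerge i)) hmerge0

end Summit.KontsevichZagierPeriods.HermiteRigidity.ReductionRigidity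

end
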